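import Summits.BirchSwinnertonDyer.Rank1Residual.Additive.RamifiedSevenGenusLatticeTypeLawScalings
import Summits.BirchSwinnertonDyer.Rank1Residual.Additive.RamifiedSevenGenusMemberType
import Literature.NumberTheory.EllipticCurves.EisensteinValuesAtSqrtNegSeven
import Literature.NumberTheory.EllipticCurves.ModularCurveNeronLatticeProofs
import HarnessLib

set_option autoImplicit false

/-!
# `𝒞₇` genus road (crux `EllipticUnitValueSevenOfGZK` = stmt-BirchSwinnertonDyer-19945, K7r): (S-P) = LEMMA P, part 2/3 —
# `Λ₋₇`-arithmetic, the TYPE TRANSPORT `c₆(W) > 0 ↔ c₆(W₂) > 0` along the `ℚ`-isogeny pair, and the member law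

Cell bsd-cm, seat bsd-cm-k-ty1 g37 (literature-prover, explicit unit, claim-free); pen bsd-cm-plan g40 D1186 (c) (ARCH-B as theorems, the
`255³` branch through `Λ₋₂₈ ⊆ Λ₋₇` + the dual scaling); critic idea-crit-15 g19 NOTE #47 (B).  Part 2 of the three-file split of the one-file
farm witness `g37/RamifiedSevenGenusLatticeTypeLaw.asannounced.lean` 59f5eded6fee373f (part 1 = `…LatticeTypeLawScalings.lean`, part 3 =
`…LatticeTypeLaw.lean` with the letter).

CONTENTS (namespace `GenusSeven.LatticeTypeLaw`; PURE KERNEL, theorems only):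
* §5 `Λ₋₇`-arithmetic: `ω₋₇ = −7/2 + i√7/2`; `z ∈ Λ₋₇ ⇒ z = mω₋₇ + n` with its real/imaginary parts;
  `Λ₋₂₈ ⊆ Λ₋₇` (`ω₋₂₈ = 2ω₋₇ − 7`); ★ `sq_re_pos_of_mem_cmPeriodPair`: `β, β' ∈ Λ₋₇`, `ββ' = K ∈ ℤ`, `7 ∤ K`, `β ≠ 0`, `β² ∈ ℝ` ⇒ `β² > 0`
  (`Im(β²) = 2 Re β Im β = 0`; `Im β = 0` gives `β ∈ ℝ ∖ 0`; `Re β = 0` gives `Re(ββ') = −Im β·Im β' = −7mm'/4 = K`, `7 ∣ 4K`);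
* §6 `exists_cm_generator_member` (`j(W) ∈ {−3375, 255³}` ⇒ `Λ_W = Ω_W·Λ_d`, `Λ_d ⊆ Λ₋₇`, `1 ∈ Λ_d`, `Ω_W² = t_W ∈ ℝ ∖ 0`, `t_W > 0 ↔ c₆(W) > 0`,
  from `Literature/…/EisensteinValuesAtSqrtNegSeven.lean`: Cox Thm. 10.9 + the singular moduli + σ₇ = σ₂₈ = +1, all PROVED) and ★ the TYPE
  TRANSPORT `c₆_pos_iff_of_isogenyPair`: for GLOBALLY MINIMAL `W` (`j ∈ {−3375, 255³}`), `W₂` (`j = −3375`) and a `ℚ`-isogeny pair `(φ₀, ψ₀)`,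
  `ψ₀φ₀ = [e] = φ₀ψ₀`, `e ∈ {1,2}`: with the integer scalings `k, k'` of part 1 (`7 ∤ kk'`), `β := kΩ_W/Ω₂`, `β' := k'Ω₂/Ω_W ∈ Λ₋₇`, `ββ' = kk'`,
  `β² = k²t_W/t₂ ∈ ℝ`, so §5 gives `t_W/t₂ > 0`: **`c₆(W) > 0 ↔ c₆(W₂) > 0`**;
* §7 the member law `c₆_neg_of_memberType_eq_zero`: `memberType W = 0 ⇒ c₆(W) < 0` (`memberType_eq_zero_iff`: `C • W` is a NEGATIVE quadratic
  twist of `B₂ = ⟨0,−42,0,−7,0⟩` (`c₆ = 4826304`) or of `B₁ = B₂.twoIsogenyCodomain` (`c₆ = 5419008`); `u⁻⁶c₆(W) = δ³c₆(B) < 0`).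

HONEST LABEL: helper theorems only (no `def`, no named fact, no `instance`, no notation, no `sorry`); nothing of the line of record is touched; stmt-BirchSwinnertonDyer-19945 stays OPEN (zp v24 df4123daf56b4e4d, 4 sorries); `X12.CMRamifiedSeven` is NOT proved; no summit statement is proved by this seat; BSD is claimed for no curve.

## References
* D. A. Cox, *Primes of the form x² + ny²*, 2nd ed. (2013), §7.A (7.1) and Lemma 7.2, Thm. 10.9, §12.C table (12.20). [Cox2013]
* J. H. Silverman, *AEC* (2009), Thm. VI.4.1 (b), Thm. VI.5.1, X §5 Prop. 5.4. [SilvermanAEC2009]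
* K. Kato, Astérisque 295 (2004), §15.11 (2) (pp. 261–262) (the members as twists of `49a1`/`49a2`). [Kato2004Asterisque]
* J. E. Cremona, *Algorithms* (1997), Table 1, N = 49. [CremonaAlgorithms1997]
* Tree: part 1 `RamifiedSevenGenusLatticeTypeLawScalings`, `Literature/…/EisensteinValuesAtSqrtNegSeven` (p831883), `RamifiedSevenGenusMemberType`,
  `ModularCurveNeronLatticeProofs` (`exists_isNeronLatticeOf_holds`).
-/

noncomputable section

open scoped NumberField
open WeierstrassCurve
open Literature.NumberTheory.EllipticCurves
open Literature.NumberTheory.EllipticCurves.ModularForms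
open Literature.NumberTheory.ComplexMultiplication.EllipticUnits

namespace Summit.BirchSwinnertonDyer.Rank1Residual.Additive.GenusSeven

namespace LatticeTypeLaw

/-! ## §5 `Λ₋₇`-arithmetic: `ω₋₇`, elements of `Λ₋₇`, `Λ₋₂₈ ⊆ Λ₋₇`, the key positivity lemma -/

/-- `Re ω₋₇ = −7/2`. [cite: Cox2013, §7.A eq. (7.1)] -/
theorem cmGen_neg_seven_re : (cmGen (-7)).re = -7 / 2 := by
  rw [cmGen_re]; norm_num

/-- `Im ω₋₇ = √7/2`. [cite: Cox2013, §7.A eq. (7.1)] -/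
theorem cmGen_neg_seven_im : (cmGen (-7)).im = Real.sqrt 7 / 2 := by
  rw [cmGen_im]; norm_num

/-- Elements of `Λ₋₇`: `z ∈ Λ₋₇ → z = m·ω₋₇ + n`. [cite: Cox2013, §7.A eq. (7.1)] -/
theorem mem_cmPeriodPair_neg_seven {z : ℂ} (hz : z ∈ (cmPeriodPair (-7)).lattice) :
    ∃ m n : ℤ, z = m * cmGen (-7) + n := by
  rw [PeriodPair.mem_lattice] at hz
  obtain ⟨m, n, h⟩ := hz
  refine ⟨m, n, ?_⟩
  rw [← h, cmPeriodPair_ω₁ (by norm_num : (-7 : ℤ) < 0), cmPeriodPair_ω₂, mul_one]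

/-- Real and imaginary parts of `m·ω₋₇ + n`. [cite: Cox2013, §7.A eq. (7.1)] -/
theorem re_im_of_eq_cmGen {z : ℂ} {m n : ℤ} (h : z = m * cmGen (-7) + n) :
    z.re = n - 7 * m / 2 ∧ z.im = m * Real.sqrt 7 / 2 := by
  rw [h]
  constructor
  · simp only [Complex.add_re, Complex.mul_re, Complex.intCast_re, Complex.intCast_im, cmGen_neg_seven_re,
      cmGen_neg_seven_im]
    ring
  · simp only [Complex.add_im, Complex.mul_im, Complex.intCast_re, Complex.intCast_im, cmGen_neg_seven_re,
      cmGen_neg_seven_im]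
    ring

/-- `Λ₋₂₈ ⊆ Λ₋₇` (`ω₋₂₈ = −14 + i√7 = 2ω₋₇ − 7`: the order `ℤ[√−7]` of conductor `2` inside `𝓞_K`). [cite: Cox2013, §7.A (orders and
their conductor; Lemma 7.2)] -/
theorem cmPeriodPair_neg_twentyeight_le : (cmPeriodPair (-28)).lattice ≤ (cmPeriodPair (-7)).lattice := by
  have h28 : Real.sqrt (-((-28 : ℤ) : ℝ)) = 2 * Real.sqrt (-((-7 : ℤ) : ℝ)) := by
    rw [show (-((-28 : ℤ) : ℝ)) = 2 ^ 2 * (-((-7 : ℤ) : ℝ)) by norm_num,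
      Real.sqrt_mul (by norm_num) _, Real.sqrt_sq (by norm_num : (0 : ℝ) ≤ 2)]
  have hω : cmGen (-28) = 2 * cmGen (-7) - 7 := by
    simp only [cmGen]
    rw [h28]
    push_cast
    ring
  intro z hz
  rw [PeriodPair.mem_lattice] at hz
  obtain ⟨m, n, h⟩ := hz
  rw [cmPeriodPair_ω₁ (by norm_num : (-28 : ℤ) < 0), cmPeriodPair_ω₂, hω] at h
  rw [PeriodPair.mem_lattice]
  refine ⟨2 * m, n - 7 * m, ?_⟩
  rw [cmPeriodPair_ω₁ (by norm_num : (-7 : ℤ) < 0), cmPeriodPair_ω₂, ← h]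
  push_cast
  ring

/-- **The `Λ₋₇`-arithmetic behind the type transport.**  Let `β, β' ∈ Λ₋₇` with `ββ' = K ∈ ℤ`, `7 ∤ K`, `β ≠ 0` and `β²` REAL.  Then
`β² > 0`: writing `β = mω + n`, `Im(β²) = 2·Re β·Im β = 0`; `Im β = 0` gives `β ∈ ℤ ∖ 0`; `Re β = 0` gives `Re(ββ') = −Im β·Im β' =
−7mm'/4 = K`, i.e. `7 ∣ 4K`. [cite: Cox2013, §7.A eq. (7.1) (𝓞_K = [1, ω], the norm form)] -/
theorem sq_re_pos_of_mem_cmPeriodPair {β β' : ℂ} (hβ : β ∈ (cmPeriodPair (-7)).lattice)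
    (hβ' : β' ∈ (cmPeriodPair (-7)).lattice) {K : ℤ} (hK : ¬ (7 : ℤ) ∣ K) (hprod : β * β' = K) (hreal : (β ^ 2).im = 0)
    (hβ0 : β ≠ 0) : 0 < (β ^ 2).re := by
  obtain ⟨m, n, hmn⟩ := mem_cmPeriodPair_neg_seven hβ
  obtain ⟨m', n', hmn'⟩ := mem_cmPeriodPair_neg_seven hβ'
  obtain ⟨-, him⟩ := re_im_of_eq_cmGen hmn
  obtain ⟨-, him'⟩ := re_im_of_eq_cmGen hmn'
  have hs7 : Real.sqrt 7 ^ 2 = 7 := Real.sq_sqrt (by norm_num)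
  have hsq_re : (β ^ 2).re = β.re * β.re - β.im * β.im := by rw [sq, Complex.mul_re]
  have hsq_im : (β ^ 2).im = β.re * β.im + β.im * β.re := by rw [sq, Complex.mul_im]
  have hK_re : β.re * β'.re - β.im * β'.im = K := by
    have h := congrArg Complex.re hprod
    rw [Complex.mul_re, Complex.intCast_re] at h
    exact h
  rw [hsq_im] at hreal
  rw [hsq_re]
  rcases mul_eq_zero.mp (show β.re * β.im = 0 by linarith) with hx | hy
  · -- `Re β = 0`: `−Im β · Im β' = K`, `7 m m' = −4 K`
    exfalso
    rw [hx, zero_mul, zero_sub, him, him'] at hK_re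
    have h7 : (7 : ℝ) * m * m' = -4 * K := by linear_combination (-4 : ℝ) * hK_re - ((m : ℝ) * m') * hs7
    have h7' : (7 : ℤ) * m * m' = -4 * K := by exact_mod_cast h7
    apply hK
    have h4 : (7 : ℤ) ∣ 4 * K := ⟨-(m * m'), by linarith⟩
    rcases prime_seven_int.dvd_or_dvd h4 with h | h
    · exact absurd h (by decide)
    · exact h
  · -- `Im β = 0`: `β = Re β ≠ 0`
    have hx : β.re ≠ 0 := fun hx ↦ hβ0 (Complex.ext (by simp [hx]) (by simp [hy]))
    rw [hy, mul_zero, sub_zero]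
    exact mul_self_pos.mpr hx

/-! ## §6 CM generators for both curves; the type TRANSPORT along the isogeny pair -/

/-- **CM generator of the member**: for `j(W) ∈ {−3375, 255³}` the Néron lattice is `Ω_W·Λ_d` with `Λ_d ⊆ Λ₋₇` (`d ∈ {−7, −28}`) and
`1 ∈ Λ_d`, `Ω_W² = t_W ∈ ℝ ∖ 0`, `t_W > 0 ↔ c₆(W) > 0`. [cite: Cox2013, Thm. 10.9 and §12.C table (12.20)] -/
theorem exists_cm_generator_member {W : WeierstrassCurve ℚ} [W.IsElliptic] {L : PeriodPair}
    (hL : IsNeronLatticeOf (W.baseChange ℂ) L) (hj : W.j = -3375 ∨ W.j = 16581375) :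
    ∃ (Λ : PeriodPair) (Ω : ℂ) (hΩ : Ω ≠ 0) (t : ℝ), Λ.lattice ≤ (cmPeriodPair (-7)).lattice ∧ (1 : ℂ) ∈ Λ.lattice ∧
      L.lattice = (Λ.mulLeft Ω hΩ).lattice ∧ t ≠ 0 ∧ Ω ^ 2 = (t : ℂ) ∧ (0 < t ↔ 0 < W.c₆) := by
  have h1 : ∀ d : ℤ, (1 : ℂ) ∈ (cmPeriodPair d).lattice := fun d ↦ by
    rw [← cmPeriodPair_ω₂ d]
    exact (cmPeriodPair d).ω₂_mem_lattice
  rcases hj with hj | hj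
  · obtain ⟨Ω, hΩ, t, hlat, ht, hsq, hiff⟩ := exists_cm_generator_of_j_eq_neg_3375 hL hj
    exact ⟨cmPeriodPair (-7), Ω, hΩ, t, le_rfl, h1 _, hlat, ht, hsq, hiff⟩
  · obtain ⟨Ω, hΩ, t, hlat, ht, hsq, hiff⟩ := exists_cm_generator_of_j_eq_16581375 hL hj
    exact ⟨cmPeriodPair (-28), Ω, hΩ, t, cmPeriodPair_neg_twentyeight_le, h1 _, hlat, ht, hsq, hiff⟩

/-- **TYPE TRANSPORT: `c₆(W) > 0 ↔ c₆(W₂) > 0`** along a `ℚ`-isogeny pair `(φ₀, ψ₀)` with `ψ₀ ∘ φ₀ = [e]`, `φ₀ ∘ ψ₀ = [e]`, `e ∈ {1,2}`,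
between GLOBALLY MINIMAL `W` (`j ∈ {−3375, 255³}`) and `W₂` (`j = −3375`): with `Λ_W = Ω_W·Λ_d`, `Λ₂ = Ω₂·Λ₋₇` and the integer
scalings `k, k'` (`7 ∤ kk'`), `β = kΩ_W/Ω₂`, `β' = k'Ω₂/Ω_W ∈ Λ₋₇`, `ββ' = kk'`, `β² = k²t_W/t₂ ∈ ℝ`, so `β² > 0`
(`sq_re_pos_of_mem_cmPeriodPair`) and `t_W`, `t₂` have the same sign. [cite: SilvermanAEC2009, Thm. VI.4.1 (b)] [cite: Cox2013, Thm. 10.9] -/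
theorem c₆_pos_iff_of_isogenyPair {W W₂ : WeierstrassCurve ℚ} [W.IsElliptic] [W₂.IsElliptic] [W.IsGloballyMinimal]
    [W₂.IsGloballyMinimal] (hjW : W.j = -3375 ∨ W.j = 16581375) (hj₂ : W₂.j = -3375)
    (φ₀ : Isogeny W W₂) (ψ₀ : Isogeny W₂ W) {e : ℤ} (he : e = 1 ∨ e = 2)
    (hψφ : ∀ P, ψ₀ (φ₀ P) = e • P) (hφψ : ∀ Q, φ₀ (ψ₀ Q) = e • Q) :
    0 < W.c₆ ↔ 0 < W₂.c₆ := by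
  haveI : (W.baseChange ℂ).IsElliptic := by rw [WeierstrassCurve.baseChange]; infer_instance
  haveI : (W₂.baseChange ℂ).IsElliptic := by rw [WeierstrassCurve.baseChange]; infer_instance
  obtain ⟨LW, hLW⟩ := exists_isNeronLatticeOf_holds (W.baseChange ℂ)
  obtain ⟨L₂, hL₂⟩ := exists_isNeronLatticeOf_holds (W₂.baseChange ℂ)
  obtain ⟨Λ, ΩW, hΩW, tW, hΛle, h1Λ, hlatW, htW, hsqW, hiffW⟩ := exists_cm_generator_member hLW hjW
  obtain ⟨Ω₂, hΩ₂, t₂, hlat₂, ht₂, hsq₂, hiff₂⟩ := exists_cm_generator_of_j_eq_neg_3375 hL₂ hj₂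
  obtain ⟨k, hk0, hkd, hkΛ⟩ := exists_int_scaling hLW hL₂ φ₀
  obtain ⟨k', hk0', hkd', hk'Λ⟩ := exists_int_scaling hL₂ hLW ψ₀
  have h7k : ¬ (7 : ℤ) ∣ k := fun h ↦ not_seven_dvd_degree φ₀ ψ₀ he hψφ (h.trans hkd)
  have h7k' : ¬ (7 : ℤ) ∣ k' := fun h ↦ not_seven_dvd_degree ψ₀ φ₀ he hφψ (h.trans hkd')
  have h7kk' : ¬ (7 : ℤ) ∣ k * k' := fun h ↦ by
    rcases prime_seven_int.dvd_or_dvd h with h' | h'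
    · exact h7k h'
    · exact h7k' h'
  -- `Ω_W ∈ Λ_W`, `Ω₂ ∈ Λ₂`
  have hΩWmem : ΩW ∈ LW.lattice := by
    rw [hlatW, PeriodPair.mem_mulLeft_lattice, inv_mul_cancel₀ hΩW]
    exact h1Λ
  have hΩ₂mem : Ω₂ ∈ L₂.lattice := by
    rw [hlat₂, PeriodPair.mem_mulLeft_lattice, inv_mul_cancel₀ hΩ₂, ← cmPeriodPair_ω₂ (-7)]
    exact (cmPeriodPair (-7)).ω₂_mem_lattice
  -- `β := Ω₂⁻¹ (k Ω_W) ∈ Λ₋₇`, `β' := Ω_W⁻¹ (k' Ω₂) ∈ Λ_d ⊆ Λ₋₇`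
  have hβ : Ω₂⁻¹ * ((k : ℂ) * ΩW) ∈ (cmPeriodPair (-7)).lattice := by
    have h := hkΛ _ hΩWmem
    rw [hlat₂, PeriodPair.mem_mulLeft_lattice] at h
    exact h
  have hβ' : ΩW⁻¹ * ((k' : ℂ) * Ω₂) ∈ (cmPeriodPair (-7)).lattice := by
    have h := hk'Λ _ hΩ₂mem
    rw [hlatW, PeriodPair.mem_mulLeft_lattice] at h
    exact hΛle h
  have hprod : Ω₂⁻¹ * ((k : ℂ) * ΩW) * (ΩW⁻¹ * ((k' : ℂ) * Ω₂)) = ((k * k' : ℤ) : ℂ) := by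
    rw [show Ω₂⁻¹ * ((k : ℂ) * ΩW) * (ΩW⁻¹ * ((k' : ℂ) * Ω₂)) = (Ω₂⁻¹ * Ω₂) * (ΩW⁻¹ * ΩW) * ((k : ℂ) * k') by ring,
      inv_mul_cancel₀ hΩ₂, inv_mul_cancel₀ hΩW, one_mul, one_mul]
    exact (Int.cast_mul k k').symm
  have hβ0 : Ω₂⁻¹ * ((k : ℂ) * ΩW) ≠ 0 :=
    mul_ne_zero (inv_ne_zero hΩ₂) (mul_ne_zero (by exact_mod_cast hk0) hΩW)
  -- `β² · t₂ = k² · t_W`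
  have ht₂C : (t₂ : ℂ) ≠ 0 := Complex.ofReal_ne_zero.mpr ht₂
  have hβsq : (Ω₂⁻¹ * ((k : ℂ) * ΩW)) ^ 2 = (((k : ℝ) ^ 2 * tW / t₂ : ℝ) : ℂ) := by
    have h1 : (Ω₂⁻¹ * ((k : ℂ) * ΩW)) ^ 2 * Ω₂ ^ 2 = (k : ℂ) ^ 2 * ΩW ^ 2 := by
      rw [show (Ω₂⁻¹ * ((k : ℂ) * ΩW)) ^ 2 * Ω₂ ^ 2 = (Ω₂⁻¹ * Ω₂) ^ 2 * ((k : ℂ) ^ 2 * ΩW ^ 2) by ring,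
        inv_mul_cancel₀ hΩ₂, one_pow, one_mul]
    rw [hsq₂, hsqW] at h1
    push_cast
    rw [eq_div_iff ht₂C, h1]
  have hreal : ((Ω₂⁻¹ * ((k : ℂ) * ΩW)) ^ 2).im = 0 := by rw [hβsq, Complex.ofReal_im]
  have hpos := sq_re_pos_of_mem_cmPeriodPair hβ hβ' h7kk' hprod hreal hβ0
  rw [hβsq, Complex.ofReal_re] at hpos
  -- `k² t_W / t₂ > 0` ⇒ same sign
  have hk2 : (0 : ℝ) < (k : ℝ) ^ 2 := by
    have hkR : (k : ℝ) ≠ 0 := by exact_mod_cast hk0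
    positivity
  have hsame : 0 < tW ↔ 0 < t₂ := by
    constructor
    · intro h
      by_contra hle
      have hle' : t₂ < 0 := lt_of_le_of_ne (not_lt.mp hle) ht₂
      have hneg : (k : ℝ) ^ 2 * tW / t₂ < 0 := div_neg_of_pos_of_neg (mul_pos hk2 h) hle'
      linarith
    · intro h
      by_contra hle
      have hle' : tW < 0 := lt_of_le_of_ne (not_lt.mp hle) htW
      have hneg : (k : ℝ) ^ 2 * tW / t₂ < 0 := div_neg_of_neg_of_pos (mul_neg_of_pos_of_neg hk2 hle') h
      linarith
  rw [← hiffW, hsame, hiff₂]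

/-! ## §7 The member law: `memberType W = 0 ⇒ c₆(W) < 0` -/

/-- `c₆(B₂) = 4826304 > 0` for `B₂ = ⟨0,−42,0,−7,0⟩` (`49a2` up to `u = 1/2`). [cite: CremonaAlgorithms1997, Table 1, N = 49] -/
theorem c₆_B₂ : (⟨0, -42, 0, -7, 0⟩ : WeierstrassCurve ℚ).c₆ = 4826304 := by
  norm_num [WeierstrassCurve.c₆, WeierstrassCurve.b₂, WeierstrassCurve.b₄, WeierstrassCurve.b₆]

/-- `c₆(B₁) = 5419008 > 0` for `B₁ = B₂.twoIsogenyCodomain = ⟨0,84,0,1792,0⟩` (`49a1` up to `u = 1/4`).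
[cite: CremonaAlgorithms1997, Table 1, N = 49] -/
theorem c₆_B₁ : ((⟨0, -42, 0, -7, 0⟩ : WeierstrassCurve ℚ).twoIsogenyCodomain).c₆ = 5419008 := by
  norm_num [WeierstrassCurve.twoIsogenyCodomain, WeierstrassCurve.c₆, WeierstrassCurve.b₂, WeierstrassCurve.b₄,
    WeierstrassCurve.b₆]

/-- **Member law: `memberType W = 0 ⇒ c₆(W) < 0`** — a negative quadratic twist `B^{(δ)}`, `δ < 0`, of `B ∈ {B₁, B₂}` (both with
`c₆ > 0`) has `u⁻⁶·c₆(W) = δ³c₆(B) < 0` for the isomorphism `C`. [cite: Kato2004Asterisque, §15.11 (2) (pp. 261–262)]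
[cite: SilvermanAEC2009, X §5 Prop. 5.4 and III §1 Table 3.1] -/
theorem c₆_neg_of_memberType_eq_zero {W : WeierstrassCurve ℚ} (h : memberType W = 0) : W.c₆ < 0 := by
  rw [memberType_eq_zero_iff] at h
  obtain ⟨δ, C, hδ, hC⟩ := h
  have hδ3 : δ ^ 3 < 0 := Odd.pow_neg (by decide) hδ
  have key : ∀ B : WeierstrassCurve ℚ, 0 < B.c₆ → C • W = B.quadraticTwist δ → W.c₆ < 0 := by
    intro B hB hCB
    have h1 := congrArg WeierstrassCurve.c₆ hCB
    rw [WeierstrassCurve.variableChange_c₆, WeierstrassCurve.quadraticTwist_c₆] at h1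
    have hu : (0 : ℚ) < ((C.u⁻¹ : ℚˣ) : ℚ) ^ 6 := Even.pow_pos (by decide) (Units.ne_zero _)
    have hneg : ((C.u⁻¹ : ℚˣ) : ℚ) ^ 6 * W.c₆ < 0 := by
      rw [h1]
      exact mul_neg_of_neg_of_pos hδ3 hB
    by_contra hle
    exact absurd hneg (not_lt.mpr (mul_nonneg hu.le (not_lt.mp hle)))
  rcases hC with hC | hC
  · exact key _ (by rw [c₆_B₁]; norm_num) hC
  · exact key _ (by rw [c₆_B₂]; norm_num) hC

end LatticeTypeLaw

end Summit.BirchSwinnertonDyer.Rank1Residual.Additive.GenusSeven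

end
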